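import Mathlib.Analysis.MellinInversion
import Mathlib.MeasureTheory.Integral.IntegralEqImproper
import Literature.Barriers.RiemannHypothesis.TuranPartialSumsMontgomeryPerron
import Literature.Analysis.SpecialFunctions.InvSqAddSqIntegral
import Literature.Analysis.SpecialFunctions.GammaVerticalBounds
import HarnessLib

/-!
# Montgomery 1983 for `C_N`, `A_N`, `V_N` — the smoothed Perron formulas (Mellin inversion)

Proofs-only companion of `Literature/Barriers/RiemannHypothesis/TuranPartialSums.lean` (named fact
`Literature.Barriers.RiemannHypothesis.montgomery1983_smoothedRemark`, Montgomery 1983, §1 p. 498: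
"our proof of the Theorem, mutatis mutandis, applies to these functions [`C_N`, `V_N`, `A_N`] as
well") and of `TuranPartialSumsMontgomeryPerron.lean` (the truncated Perron formula (5)/(20) of the
source for the sharp cut-off). No named facts; the two definitions are the concrete Mellin weights.

§2 of the source writes the twisted section as `F_N(s) = (1/2πi)∫ f(s+w) N^w dw/w` ((3)) and moves the
line of integration to the abscissa `α = 1 − σ + 1/log N < 0`, across the pole of the kernel `1/w`
at `w = 0` with residue `f(s)` ((5)). "Mutatis mutandis" for the smoothed sections the kernel `1/w`
becomes `1/(w(w+1))` (Cesàro weights `(1 − n/N)₊`), `Γ(w)` (Abel weights `e^{-n/N}`), and `1/w` with the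
Dirichlet series `f` replaced by `(2a(2)2^{-s} − 1) f(s)` (alternating signs). On a line `−1 < Re w < 0`
the first two kernels are absolutely integrable, so the shifted formula (5) holds EXACTLY, and we prove
it directly on that line — as the Mellin inversion formula (Mathlib's `mellinInv_mellin_eq`) for the
weight minus its value at `0`:

* `integral_LSeries_mul_kernel_eq` — for `|a(n)| ≤ 1`, `Re s + α > 1`, a weight `g` with Mellin
  transform `κ` on `Re w = α` (absolutely convergent there, `κ` integrable on the line):
  `∫ f(s+α+iy) x^{α+iy} κ(α+iy) dy = 2π Σ_n a(n) n^{-s} g(n/x)` (termwise Mellin inversion, the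
  interchange justified by absolute convergence);
* `cesaroWeight u = −min(u,1)`, with `mellin = 1/(w(w+1))` on `−1 < Re w < 0`
  (`mellin_cesaroWeight`), whence (`cesaro_twisted_eq`)
  `Σ_{n ≤ N} (1 − n/N) a(n) n^{-s} = f(s) + (1/2π) ∫ f(s+α+iy) N^{α+iy}/((α+iy)(α+1+iy)) dy`;
* `abelWeight u = e^{-u} − 1`, with `mellin = Γ(w)` on `−1 < Re w < 0` (`mellin_abelWeight`, one
  integration by parts on `(0, ∞)` against `t^w/w`), `‖Γ(w)‖ ≤ Γ(Re w + 2)/(‖w‖‖w+1‖)` on that strip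
  (`norm_Gamma_le_of_re_mem`, from the tree's `GammaVert.norm_Gamma_le_Gamma_re`), whence (`abel_twisted_eq`)
  `Σ_n e^{-n/N} a(n) n^{-s} = f(s) + (1/2π) ∫ f(s+α+iy) N^{α+iy} Γ(α+iy) dy`;
* `LSeries_alternating_eq` — for a completely multiplicative `a`:
  `Σ (−1)ⁿ a(n) n^{-z} = (2a(2)2^{-z} − 1) Σ a(n) n^{-z}` (`Re z > 1`), the Dirichlet series entering
  the truncated Perron formula `norm_perron_left_add_le` for `V_N`.

## References

* [Montgomery1983] H. L. Montgomery, *Zeros of approximations to the zeta function*, Studies in Pure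
  Mathematics (Turán memorial), Birkhäuser 1983, 497–506: §1 p. 498 (`C_N`, `V_N`, `A_N`), §2 (3)–(5).
* [MontgomeryVaughan2007] H. L. Montgomery, R. C. Vaughan, *Multiplicative Number Theory I*, CUP 2007,
  §5.1 (Perron's formula and its smoothed forms, (5.17)–(5.22): the kernels `1/(w(w+1))`, `Γ(w)`).
-/

noncomputable section

open Complex Set MeasureTheory Filter Topology
open Literature.NumberTheory.LFunctions Literature.Analysis.SpecialFunctions

namespace Literature.Barriers.RiemannHypothesis

/-! ## Termwise Mellin inversion against a Dirichlet series -/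

section MellinPerron

variable {a : ℕ → ℂ}

/-- For `p > 0`: `p^{-w} = (1/p)^{w}` (principal branches). [folklore] -/
theorem ofReal_cpow_neg_eq_inv_cpow {p : ℝ} (hp : 0 < p) (w : ℂ) :
    (p : ℂ) ^ (-w) = ((p⁻¹ : ℝ) : ℂ) ^ w := by
  rw [cpow_neg, ofReal_inv,
    inv_cpow _ _ (by rw [arg_ofReal_of_nonneg hp.le]; exact Real.pi_ne_zero.symm)]

/-- **Smoothed Perron formula by Mellin inversion.** Let `|a(n)| ≤ 1`, `f(z) = Σ a(n) n^{-z}`,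
`Re s + α > 1`, `x > 0`, and let `g` be a weight on `(0, ∞)` whose Mellin transform converges
absolutely on the line `Re w = α` with values `κ(w)` there, `κ` integrable along the line and `g`
continuous. Then `∫ f(s+α+iy) x^{α+iy} κ(α+iy) dy = 2π Σ_n a(n) n^{-s} g(n/x)`: the term `n` is
Mathlib's Mellin inversion formula at the point `n/x`, and the interchange of sum and integral is
justified by `Σ_n n^{-Re s}(x/n)^α ∫|κ| < ∞`. [cite: MontgomeryVaughan2007, §5.1 (5.17)–(5.22)] -/
theorem integral_LSeries_mul_kernel_eq (ha : ∀ n, ‖a n‖ ≤ 1) {s : ℂ} {α : ℝ} (hσ : 1 < s.re + α)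
    {g : ℝ → ℂ} {κ : ℂ → ℂ} (hg : MellinConvergent g α)
    (hκ : ∀ y : ℝ, mellin g (α + y * I) = κ (α + y * I))
    (hκi : Integrable fun y : ℝ ↦ κ (α + y * I))
    (hgc : ∀ u : ℝ, 0 < u → ContinuousAt g u) {x : ℝ} (hx : 0 < x) :
    ∫ y : ℝ, LSeries a (s + α + y * I) * (x : ℂ) ^ ((α : ℂ) + y * I) * κ (α + y * I) =
      2 * Real.pi * ∑' n : ℕ, LSeries.term a s n * g ((n : ℝ) / x) := by
  set F : ℕ → ℝ → ℂ := fun n y ↦ LSeries.term a s n *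
    ((((x / n : ℝ)) : ℂ) ^ ((α : ℂ) + y * I) * κ (α + y * I)) with hF
  -- (1) Mellin inversion at the point `n / x`
  have hinv : ∀ n : ℕ, n ≠ 0 →
      ∫ y : ℝ, (((x / n : ℝ)) : ℂ) ^ ((α : ℂ) + y * I) * κ (α + y * I) =
        2 * Real.pi * g ((n : ℝ) / x) := by
    intro n hn
    have hn0 : (0 : ℝ) < n := by exact_mod_cast Nat.pos_of_ne_zero hn
    have hu : 0 < (n : ℝ) / x := div_pos hn0 hx
    have hVI : VerticalIntegrable (mellin g) α :=
      hκi.congr (Eventually.of_forall fun y ↦ (hκ y).symm)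
    have key := mellinInv_mellin_eq α g hu hg hVI (hgc _ hu)
    rw [mellinInv] at key
    have h2 : ∫ y : ℝ, ((((n : ℝ) / x : ℝ)) : ℂ) ^ (-((α : ℂ) + y * I)) • mellin g (α + y * I) =
        ∫ y : ℝ, (((x / n : ℝ)) : ℂ) ^ ((α : ℂ) + y * I) * κ (α + y * I) := by
      refine integral_congr_ae (Eventually.of_forall fun y ↦ ?_)
      simp only [smul_eq_mul]
      rw [hκ y, ofReal_cpow_neg_eq_inv_cpow hu, inv_div]
    rw [h2, Complex.real_smul] at key
    have hπ : (2 * Real.pi : ℂ) * ((1 / (2 * Real.pi) : ℝ) : ℂ) = 1 := by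
      push_cast
      field_simp
    rw [← key, ← mul_assoc, hπ, one_mul]
  -- (2) the integrals of the terms
  have hFint : ∀ n, ∫ y, F n y = 2 * Real.pi * (LSeries.term a s n * g ((n : ℝ) / x)) := by
    intro n
    rcases eq_or_ne n 0 with rfl | hn
    · simp [hF]
    · simp only [hF]
      rw [integral_const_mul, hinv n hn]
      ring
  -- (3) integrability of the terms and summability of their `L¹` norms
  have hcont : ∀ n : ℕ, n ≠ 0 → Continuous fun y : ℝ ↦ (((x / n : ℝ)) : ℂ) ^ ((α : ℂ) + y * I) := by
    intro n hn
    have hn0 : (0 : ℝ) < n := by exact_mod_cast Nat.pos_of_ne_zero hn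
    have hy0 : 0 < x / n := div_pos hx hn0
    exact continuous_iff_continuousAt.2 fun y ↦
      ((differentiable_const_cpow hy0 _).continuousAt).comp
        (f := fun y : ℝ ↦ (α : ℂ) + y * I) (by fun_prop)
  have hFi : ∀ n, Integrable (F n) := by
    intro n
    rcases eq_or_ne n 0 with rfl | hn
    · simp only [hF, LSeries.term_zero, zero_mul]; exact integrable_zero _ _ _
    have hn0 : (0 : ℝ) < n := by exact_mod_cast Nat.pos_of_ne_zero hn
    have hy0 : 0 < x / n := div_pos hx hn0
    simp only [hF]
    simp_rw [← mul_assoc]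
    refine hκi.bdd_mul ((continuous_const.mul (hcont n hn)).aestronglyMeasurable)
      (c := ‖LSeries.term a s n‖ * (x / n) ^ α) (Eventually.of_forall fun y ↦ ?_)
    rw [norm_mul, norm_cpow_line hy0]
  have hnormF : ∀ n y, ‖F n y‖ = ‖LSeries.term a s n‖ * (x / n) ^ α * ‖κ (α + y * I)‖ := by
    intro n y
    rcases eq_or_ne n 0 with rfl | hn
    · simp [hF]
    have hn0 : (0 : ℝ) < n := by exact_mod_cast Nat.pos_of_ne_zero hn
    simp only [hF, norm_mul, norm_cpow_line (div_pos hx hn0)]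
    ring
  have hFsum : Summable fun n ↦ ∫ y, ‖F n y‖ := by
    have hval : ∀ n, ∫ y, ‖F n y‖ = ‖LSeries.term a s n‖ * (x / n) ^ α * ∫ y : ℝ, ‖κ (α + y * I)‖ := by
      intro n
      simp_rw [hnormF n]
      exact MeasureTheory.integral_const_mul (μ := volume) (‖LSeries.term a s n‖ * (x / n) ^ α)
        (fun y : ℝ ↦ ‖κ (α + y * I)‖)
    simp_rw [hval]
    set Iκ : ℝ := ∫ y : ℝ, ‖κ (α + y * I)‖ with hIκ
    have hI0 : 0 ≤ Iκ := integral_nonneg fun y ↦ norm_nonneg _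
    have hb : Summable fun n : ℕ ↦ x ^ α * Iκ * (n : ℝ) ^ (-(s.re + α)) :=
      (Real.summable_nat_rpow.2 (by linarith)).mul_left _
    refine Summable.of_nonneg_of_le (fun n ↦ ?_) (fun n ↦ ?_) hb
    · rcases eq_or_ne n 0 with rfl | hn
      · simp
      have hn0 : (0 : ℝ) < n := by exact_mod_cast Nat.pos_of_ne_zero hn
      exact mul_nonneg (mul_nonneg (norm_nonneg _) (Real.rpow_nonneg (div_pos hx hn0).le _)) hI0
    · rcases eq_or_ne n 0 with rfl | hn
      · simp only [LSeries.term_zero, norm_zero, zero_mul]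
        exact mul_nonneg (mul_nonneg (Real.rpow_nonneg hx.le _) hI0) (Real.rpow_nonneg (Nat.cast_nonneg 0) _)
      have hn0 : (0 : ℝ) < n := by exact_mod_cast Nat.pos_of_ne_zero hn
      have h1 := norm_term_le_rpow ha s n
      calc ‖LSeries.term a s n‖ * (x / n) ^ α * Iκ ≤ (n : ℝ) ^ (-s.re) * (x / n) ^ α * Iκ := by
            gcongr
        _ = x ^ α * Iκ * (n : ℝ) ^ (-(s.re + α)) := by
            rw [Real.div_rpow hx.le hn0.le, neg_add, Real.rpow_add hn0, Real.rpow_neg hn0.le α]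
            field_simp
  -- (4) the pointwise sum `Σ_n F n y = f(s+α+iy) x^{α+iy} κ(α+iy)`
  have hsumF : ∀ y : ℝ, HasSum (fun n ↦ F n y)
      (LSeries a (s + α + y * I) * (x : ℂ) ^ ((α : ℂ) + y * I) * κ (α + y * I)) := by
    intro y
    have hre : 1 < (s + ((α : ℂ) + y * I)).re := by simp; linarith
    have hL := (LSeriesSummable_of_bounded_of_one_lt_re (m := 1) (fun n _ ↦ ha n) hre).hasSum
    have := hL.mul_right ((x : ℂ) ^ ((α : ℂ) + y * I) * κ (α + y * I))
    simp only [hF, ← add_assoc, ← mul_assoc] at this ⊢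
    refine this.congr_fun fun n ↦ ?_
    rw [add_assoc, term_add_mul_cpow hx.le]
  -- (5) conclusion
  calc ∫ y : ℝ, LSeries a (s + α + y * I) * (x : ℂ) ^ ((α : ℂ) + y * I) * κ (α + y * I)
      = ∫ y : ℝ, ∑' n : ℕ, F n y :=
        integral_congr_ae (Eventually.of_forall fun y ↦ ((hsumF y).tsum_eq).symm)
    _ = ∑' n : ℕ, ∫ y, F n y := (integral_tsum_of_summable_integral_norm hFi hFsum).symm
    _ = ∑' n : ℕ, 2 * Real.pi * (LSeries.term a s n * g ((n : ℝ) / x)) := tsum_congr hFint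
    _ = _ := tsum_mul_left

end MellinPerron

/-! ## Integrable majorants on a vertical line -/

/-- `1/(‖w‖‖w+1‖) ≤ 1/(α²+y²) + 1/((α+1)²+y²)` for `w = α + iy` off the poles. [folklore] -/
theorem inv_norm_mul_norm_add_one_le {α : ℝ} (hα0 : α ≠ 0) (hα1 : α + 1 ≠ 0) (y : ℝ) :
    1 / (‖(α : ℂ) + y * I‖ * ‖(α : ℂ) + y * I + 1‖) ≤
      1 / (α ^ 2 + y ^ 2) + 1 / ((α + 1) ^ 2 + y ^ 2) := by
  set A : ℝ := ‖(α : ℂ) + y * I‖ with hA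
  set B : ℝ := ‖(α : ℂ) + y * I + 1‖ with hB
  have hsq : ∀ σ : ℝ, ‖(σ : ℂ) + y * I‖ ^ 2 = σ ^ 2 + y ^ 2 := by
    intro σ
    rw [Complex.sq_norm, Complex.normSq_apply]
    simp
    ring
  have hA2 : A ^ 2 = α ^ 2 + y ^ 2 := hsq α
  have hB2 : B ^ 2 = (α + 1) ^ 2 + y ^ 2 := by
    rw [hB, show (α : ℂ) + y * I + 1 = ((α + 1 : ℝ) : ℂ) + y * I by push_cast; ring]
    exact hsq _
  have hA0 : 0 < A := norm_pos_iff.2 fun h ↦ hα0 (by simpa using congrArg re h)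
  have hB0 : 0 < B := norm_pos_iff.2 fun h ↦ hα1 (by
    have := congrArg re h; simp at this; linarith)
  rw [← hA2, ← hB2]
  rcases le_total A B with hAB | hAB
  · have h1 : 1 / (A * B) ≤ 1 / A ^ 2 := by
      rw [pow_two]
      exact one_div_le_one_div_of_le (mul_pos hA0 hA0) (mul_le_mul_of_nonneg_left hAB hA0.le)
    have h2 : 0 ≤ 1 / B ^ 2 := by positivity
    linarith
  · have h1 : 1 / (A * B) ≤ 1 / B ^ 2 := by
      rw [pow_two]
      exact one_div_le_one_div_of_le (mul_pos hB0 hB0) (mul_le_mul_of_nonneg_right hAB hB0.le)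
    have h2 : 0 ≤ 1 / A ^ 2 := by positivity
    linarith

/-! ## The Cesàro weight `−min(u, 1)` and its Mellin transform `1/(w(w+1))` -/

/-- The Cesàro weight minus its value at the origin: `g_C(u) = (1 − u)₊ − 1 = −min(u, 1)` (`u > 0`), so
that `Σ_n a(n)n^{-s} g_C(n/N) = Σ_{n ≤ N}(1 − n/N)a(n)n^{-s} − f(s)`. [cite: MontgomeryVaughan2007, §5.1 (5.18)] -/
def cesaroWeight (u : ℝ) : ℂ := -((min u 1 : ℝ) : ℂ)

/-- `g_C` is continuous. [folklore] -/
theorem continuous_cesaroWeight : Continuous cesaroWeight := by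
  unfold cesaroWeight; fun_prop

/-- `‖g_C(u)‖ ≤ 1` for `u ≥ 0`. [folklore] -/
theorem norm_cesaroWeight_le {u : ℝ} (hu : 0 ≤ u) : ‖cesaroWeight u‖ ≤ 1 := by
  rw [cesaroWeight, norm_neg, norm_real, Real.norm_eq_abs, abs_of_nonneg (le_min hu zero_le_one)]
  exact min_le_right _ _

/-- **The Mellin transform of the Cesàro weight**: for `−1 < Re w < 0`, `g_C` is Mellin-integrable at
`w` with `∫_0^∞ t^{w−1} g_C(t) dt = −∫_0^1 t^w dt − ∫_1^∞ t^{w−1} dt = −1/(w+1) + 1/w = 1/(w(w+1))`.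
[cite: MontgomeryVaughan2007, §5.1 (5.18)] -/
theorem hasMellin_cesaroWeight {w : ℂ} (hw1 : -1 < w.re) (hw0 : w.re < 0) :
    HasMellin cesaroWeight w (1 / (w * (w + 1))) := by
  have hw_ne : w ≠ 0 := by rintro rfl; simp at hw0
  have hw1_ne : w + 1 ≠ 0 := by
    intro h; have := congrArg re h; simp at this; linarith
  -- the two pieces of `(0, ∞)`
  have hsplit : Ioi (0 : ℝ) = Ioc 0 1 ∪ Ioi 1 := (Ioc_union_Ioi_eq_Ioi zero_le_one).symm
  have hdisj : Disjoint (Ioc (0 : ℝ) 1) (Ioi 1) := by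
    rw [Set.disjoint_iff]; rintro t ⟨h1, h2⟩; exact absurd h1.2 (not_le.2 h2)
  set G : ℝ → ℂ := fun t ↦ (t : ℂ) ^ (w - 1) • cesaroWeight t with hG
  -- on `(0, 1]`: `G t = −t^w`
  have hG1 : ∀ t ∈ Ioc (0 : ℝ) 1, G t = -(t : ℂ) ^ w := by
    intro t ht
    have ht0 : (t : ℂ) ≠ 0 := ofReal_ne_zero.2 ht.1.ne'
    simp only [hG, cesaroWeight, min_eq_left ht.2, smul_eq_mul]
    rw [cpow_sub _ _ ht0, cpow_one]
    field_simp
  -- on `(1, ∞)`: `G t = −t^{w−1}`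
  have hG2 : ∀ t ∈ Ioi (1 : ℝ), G t = -(t : ℂ) ^ (w - 1) := by
    intro t ht
    simp only [hG, cesaroWeight, min_eq_right (le_of_lt (mem_Ioi.1 ht)), smul_eq_mul]
    push_cast; ring
  -- integrability on the pieces
  have hint1 : IntegrableOn G (Ioc 0 1) := by
    have h : IntegrableOn (fun t : ℝ ↦ -(t : ℂ) ^ w) (Ioc 0 1) := by
      have := (intervalIntegral.intervalIntegrable_cpow' (a := 0) (b := 1) hw1).neg
      rwa [intervalIntegrable_iff_integrableOn_Ioc_of_le zero_le_one] at this
    exact h.congr_fun (fun t ht ↦ (hG1 t ht).symm) measurableSet_Ioc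
  have hint2 : IntegrableOn G (Ioi 1) := by
    have h : IntegrableOn (fun t : ℝ ↦ -(t : ℂ) ^ (w - 1)) (Ioi 1) :=
      (integrableOn_Ioi_cpow_of_lt (by simp; linarith) zero_lt_one).neg
    exact h.congr_fun (fun t ht ↦ (hG2 t ht).symm) measurableSet_Ioi
  -- values on the pieces
  have hval1 : ∫ t in Ioc (0 : ℝ) 1, G t = -(1 / (w + 1)) := by
    rw [setIntegral_congr_fun measurableSet_Ioc hG1, integral_neg,
      ← intervalIntegral.integral_of_le zero_le_one, integral_cpow (Or.inl hw1)]
    simp [zero_cpow hw1_ne]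
  have hval2 : ∫ t in Ioi (1 : ℝ), G t = 1 / w := by
    rw [setIntegral_congr_fun measurableSet_Ioi hG2, integral_neg,
      integral_Ioi_cpow_of_lt (by simp; linarith) zero_lt_one]
    simp only [sub_add_cancel, ofReal_one, one_cpow]
    field_simp
  refine ⟨?_, ?_⟩
  · show IntegrableOn G (Ioi 0)
    rw [hsplit]; exact hint1.union hint2
  · show ∫ t in Ioi (0 : ℝ), G t = 1 / (w * (w + 1))
    rw [hsplit, setIntegral_union hdisj measurableSet_Ioi hint1 hint2, hval1, hval2]
    field_simp
    ring

/-- The Cesàro kernel `1/(w(w+1))` is integrable along every line `Re w = α`, `α ∉ {0, −1}`. [folklore] -/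
theorem integrable_cesaroKernel_line {α : ℝ} (hα0 : α ≠ 0) (hα1 : α + 1 ≠ 0) :
    Integrable fun y : ℝ ↦ 1 / (((α : ℂ) + y * I) * ((α : ℂ) + y * I + 1)) := by
  have hne : ∀ y : ℝ, ((α : ℂ) + y * I) * ((α : ℂ) + y * I + 1) ≠ 0 := by
    intro y
    refine mul_ne_zero ?_ ?_
    · intro h; have := congrArg re h; simp at this; exact hα0 this
    · intro h; have := congrArg re h; simp at this; exact hα1 (by linarith)
  have hcont : Continuous fun y : ℝ ↦ 1 / (((α : ℂ) + y * I) * ((α : ℂ) + y * I + 1)) :=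
    Continuous.div continuous_const (by fun_prop) hne
  refine Integrable.mono' ((integrable_one_div_sq_add_sq_of_ne_zero hα0).add
    (integrable_one_div_sq_add_sq_of_ne_zero hα1))
    hcont.aestronglyMeasurable (Eventually.of_forall fun y ↦ ?_)
  rw [norm_div, norm_one, norm_mul]
  exact inv_norm_mul_norm_add_one_le hα0 hα1 y

/-- **The smoothed Perron formula for the Cesàro means** (Montgomery's (5) "mutatis mutandis"): for
`|a(n)| ≤ 1`, `−1 < α < 0`, `Re s + α > 1` and `N ≥ 1`,
`Σ_{n ≤ N} (1 − n/N) a(n) n^{-s} = f(s) + (1/2π) ∫ f(s+α+iy) N^{α+iy} /((α+iy)(α+iy+1)) dy`.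
[cite: Montgomery1983, §1 p. 498 and §2 (5)] [cite: MontgomeryVaughan2007, §5.1 (5.18)] -/
theorem cesaro_twisted_eq {a : ℕ → ℂ} (ha : ∀ n, ‖a n‖ ≤ 1) {s : ℂ} {α : ℝ} (hα1 : -1 < α)
    (hα0 : α < 0) (hσ : 1 < s.re + α) {N : ℕ} (hN : 0 < N) :
    ∑ n ∈ Finset.Icc 1 N, (1 - (n : ℂ) / N) * a n * (n : ℂ) ^ (-s) =
      LSeries a s + (1 / (2 * Real.pi)) * ∫ y : ℝ, LSeries a (s + α + y * I) *
        (N : ℂ) ^ ((α : ℂ) + y * I) * (1 / (((α : ℂ) + y * I) * ((α : ℂ) + y * I + 1))) := by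
  have hs1 : 1 < s.re := by linarith
  have hN0 : (0 : ℝ) < N := by exact_mod_cast hN
  -- the Mellin data of the weight on the line `Re w = α`
  have hre : ∀ y : ℝ, ((α : ℂ) + y * I).re = α := fun y ↦ by simp
  have hM : ∀ y : ℝ, HasMellin cesaroWeight ((α : ℂ) + y * I)
      (1 / (((α : ℂ) + y * I) * ((α : ℂ) + y * I + 1))) :=
    fun y ↦ hasMellin_cesaroWeight (by rw [hre]; exact hα1) (by rw [hre]; exact hα0)
  have hg : MellinConvergent cesaroWeight α := by
    have := (hM 0).1; simpa using this
  have key := integral_LSeries_mul_kernel_eq ha hσ (g := cesaroWeight)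
    (κ := fun w ↦ 1 / (w * (w + 1))) hg (fun y ↦ (hM y).2)
    (integrable_cesaroKernel_line hα0.ne (by linarith))
    (fun u _ ↦ continuous_cesaroWeight.continuousAt) hN0
  -- the right-hand side: `Σ_n term a s n · g_C(n/N) = Σ_{n ≤ N}(1 − n/N) a(n) n^{-s} − f(s)`
  set A : ℕ → ℂ := fun n ↦ if n ≤ N then (1 - (n : ℂ) / N) * LSeries.term a s n else 0 with hA
  have hpt : ∀ n : ℕ, LSeries.term a s n * cesaroWeight ((n : ℝ) / N) = A n - LSeries.term a s n := by
    intro n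
    rcases eq_or_ne n 0 with rfl | hn
    · simp [hA]
    simp only [hA, cesaroWeight]
    by_cases hnN : n ≤ N
    · have hle : (n : ℝ) / N ≤ 1 := by
        rw [div_le_one hN0]; exact_mod_cast hnN
      rw [if_pos hnN, min_eq_left hle]
      push_cast
      ring
    · have hge : 1 ≤ (n : ℝ) / N := by
        rw [le_div_iff₀ hN0, one_mul]; exact_mod_cast (not_le.1 hnN).le
      rw [if_neg hnN, min_eq_right hge]
      push_cast
      ring
  have hL : Summable fun n ↦ LSeries.term a s n :=
    LSeriesSummable_of_bounded_of_one_lt_re (m := 1) (fun n _ ↦ ha n) hs1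
  have hAfin : ∀ n ∉ Finset.range (N + 1), A n = 0 := by
    intro n hn
    rw [Finset.mem_range, not_lt] at hn
    simp only [hA]; rw [if_neg (by omega)]
  have hAsum : Summable A := summable_of_ne_finset_zero hAfin
  have hAval : ∑' n, A n = ∑ n ∈ Finset.Icc 1 N, (1 - (n : ℂ) / N) * a n * (n : ℂ) ^ (-s) := by
    rw [tsum_eq_sum hAfin, Finset.range_eq_Ico, Finset.sum_eq_sum_Ico_succ_bot (Nat.succ_pos N)]
    simp only [hA, Nat.zero_le, if_true, LSeries.term_zero, mul_zero, zero_add]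
    have hI : Finset.Ico 1 (N + 1) = Finset.Icc 1 N := by
      ext n; simp only [Finset.mem_Ico, Finset.mem_Icc]; omega
    rw [hI]
    refine Finset.sum_congr rfl fun n hn ↦ ?_
    rw [Finset.mem_Icc] at hn
    rw [if_pos hn.2, LSeries.term_of_ne_zero (by omega), cpow_neg, div_eq_mul_inv]
    ring
  have htsum : ∑' n : ℕ, LSeries.term a s n * cesaroWeight ((n : ℝ) / N) =
      (∑ n ∈ Finset.Icc 1 N, (1 - (n : ℂ) / N) * a n * (n : ℂ) ^ (-s)) - LSeries a s := by
    rw [tsum_congr hpt, hAsum.tsum_sub hL, hAval, LSeries]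
  rw [htsum] at key
  have hx : ((N : ℝ) : ℂ) = (N : ℂ) := by push_cast; rfl
  rw [hx] at key
  rw [key]
  have hπ : (2 * Real.pi : ℂ) ≠ 0 := by exact_mod_cast (mul_ne_zero two_ne_zero Real.pi_ne_zero)
  field_simp
  ring

/-! ## The Abel weight `e^{-u} − 1` and its Mellin transform `Γ(w)` -/

/-- The Abel weight minus its value at the origin: `g_A(u) = e^{-u} − 1`, so that
`Σ_n a(n)n^{-s} g_A(n/N) = Σ_n e^{-n/N}a(n)n^{-s} − f(s)`. [cite: MontgomeryVaughan2007, §5.1 (5.22)] -/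
def abelWeight (u : ℝ) : ℂ := ((Real.exp (-u) - 1 : ℝ) : ℂ)

/-- `g_A` is continuous. [folklore] -/
theorem continuous_abelWeight : Continuous abelWeight := by
  unfold abelWeight; fun_prop

/-- `|e^{-u} − 1| ≤ min(u, 1)` for `u ≥ 0`. [folklore] -/
theorem norm_abelWeight_le {u : ℝ} (hu : 0 ≤ u) : ‖abelWeight u‖ ≤ min u 1 := by
  rw [abelWeight, norm_real, Real.norm_eq_abs]
  have h1 : Real.exp (-u) ≤ 1 := by rw [Real.exp_le_one_iff]; linarith
  have h2 : 0 < Real.exp (-u) := Real.exp_pos _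
  have h3 : -u + 1 ≤ Real.exp (-u) := Real.add_one_le_exp _
  rw [abs_of_nonpos (by linarith)]
  exact le_min (by linarith) (by linarith)

/-- The derivative of `g_A`: `g_A'(u) = −e^{-u}`. [folklore] -/
theorem hasDerivAt_abelWeight (u : ℝ) :
    HasDerivAt abelWeight (-((Real.exp (-u) : ℝ) : ℂ)) u := by
  have h : HasDerivAt (fun u : ℝ ↦ Real.exp (-u) - 1) (-Real.exp (-u)) u := by
    have := ((Real.hasDerivAt_exp (-u)).comp u (hasDerivAt_neg u)).sub_const 1
    simpa using this
  have h2 : HasDerivAt (fun u : ℝ ↦ ((Real.exp (-u) - 1 : ℝ) : ℂ)) (((-Real.exp (-u) : ℝ)) : ℂ) u :=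
    h.ofReal_comp
  rw [ofReal_neg] at h2
  exact h2

/-- **`g_A` is Mellin-integrable on `−1 < Re w < 0`** (`|t^{w−1} g_A(t)| ≤ t^{Re w}` on `(0,1]`,
`≤ t^{Re w − 1}` on `(1,∞)`). [folklore] -/
theorem mellinConvergent_abelWeight {w : ℂ} (hw1 : -1 < w.re) (hw0 : w.re < 0) :
    MellinConvergent abelWeight w := by
  have hsplit : Ioi (0 : ℝ) = Ioc 0 1 ∪ Ioi 1 := (Ioc_union_Ioi_eq_Ioi zero_le_one).symm
  have hmeas : AEStronglyMeasurable (fun t : ℝ ↦ (t : ℂ) ^ (w - 1) • abelWeight t)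
      (volume.restrict (Ioi 0)) := by
    refine ContinuousOn.aestronglyMeasurable (fun t ht ↦ ?_) measurableSet_Ioi
    exact ((continuousAt_ofReal_cpow_const _ _ (Or.inr (ne_of_gt ht))).smul
      continuous_abelWeight.continuousAt).continuousWithinAt
  rw [MellinConvergent, hsplit]
  refine IntegrableOn.union ?_ ?_
  · -- `(0, 1]`: dominated by `t^{Re w}`
    have hdom : IntegrableOn (fun t : ℝ ↦ t ^ w.re) (Ioc 0 1) := by
      have := intervalIntegral.intervalIntegrable_rpow' (a := 0) (b := 1) hw1
      rwa [intervalIntegrable_iff_integrableOn_Ioc_of_le zero_le_one] at this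
    refine Integrable.mono' hdom (hmeas.mono_measure (Measure.restrict_mono Ioc_subset_Ioi_self le_rfl)) ?_
    refine (ae_restrict_iff' measurableSet_Ioc).2 (Eventually.of_forall fun t ht ↦ ?_)
    rw [norm_smul, norm_cpow_eq_rpow_re_of_pos ht.1, sub_re, one_re]
    calc t ^ (w.re - 1) * ‖abelWeight t‖ ≤ t ^ (w.re - 1) * t :=
          mul_le_mul_of_nonneg_left ((norm_abelWeight_le ht.1.le).trans (min_le_left _ _))
            (Real.rpow_nonneg ht.1.le _)
      _ = t ^ w.re := by rw [Real.rpow_sub_one ht.1.ne', div_mul_cancel₀ _ ht.1.ne']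
  · -- `(1, ∞)`: dominated by `t^{Re w − 1}`
    have hdom : IntegrableOn (fun t : ℝ ↦ t ^ (w.re - 1)) (Ioi 1) :=
      integrableOn_Ioi_rpow_of_lt (by linarith) zero_lt_one
    refine Integrable.mono' hdom (hmeas.mono_measure (Measure.restrict_mono (Ioi_subset_Ioi zero_le_one) le_rfl)) ?_
    refine (ae_restrict_iff' measurableSet_Ioi).2 (Eventually.of_forall fun t ht ↦ ?_)
    have ht0 : 0 < t := zero_lt_one.trans ht
    rw [norm_smul, norm_cpow_eq_rpow_re_of_pos ht0, sub_re, one_re]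
    calc t ^ (w.re - 1) * ‖abelWeight t‖ ≤ t ^ (w.re - 1) * 1 :=
          mul_le_mul_of_nonneg_left ((norm_abelWeight_le ht0.le).trans (min_le_right _ _))
            (Real.rpow_nonneg ht0.le _)
      _ = t ^ (w.re - 1) := mul_one _

/-- **The Mellin transform of the Abel weight**: for `−1 < Re w < 0`,
`∫_0^∞ t^{w−1}(e^{-t} − 1) dt = Γ(w)` — one integration by parts against `t^w/w` (the boundary terms
vanish since `−1 < Re w < 0`), leaving `(1/w)∫_0^∞ e^{-t} t^{w} dt = Γ(w+1)/w = Γ(w)`.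
[cite: MontgomeryVaughan2007, §5.1 (5.22)] -/
theorem mellin_abelWeight {w : ℂ} (hw1 : -1 < w.re) (hw0 : w.re < 0) :
    mellin abelWeight w = Gamma w := by
  have hw_ne : w ≠ 0 := by rintro rfl; simp at hw0
  have hwm1 : w - 1 ≠ -1 := by intro h; apply hw_ne; linear_combination h
  -- `u = g_A`, `v = t^w / w`
  set v : ℝ → ℂ := fun t ↦ (t : ℂ) ^ (w - 1 + 1) / (w - 1 + 1) with hv
  have hv' : ∀ t ∈ Ioi (0 : ℝ), HasDerivAt v ((t : ℂ) ^ (w - 1)) t := fun t ht ↦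
    hasDerivAt_ofReal_cpow_const' (ne_of_gt ht) hwm1
  have hvt : ∀ t : ℝ, v t = (t : ℂ) ^ w / w := by intro t; simp [hv]
  -- integrability of `u v'` (Mellin convergence) and of `u' v` (the Gamma integral)
  have huv' : IntegrableOn (fun t : ℝ ↦ abelWeight t * (t : ℂ) ^ (w - 1)) (Ioi 0) := by
    have := mellinConvergent_abelWeight hw1 hw0
    rw [MellinConvergent] at this
    exact this.congr_fun (fun t _ ↦ by simp [smul_eq_mul, mul_comm]) measurableSet_Ioi
  have hΓ : IntegrableOn (fun t : ℝ ↦ ((Real.exp (-t) : ℝ) : ℂ) * (t : ℂ) ^ w) (Ioi 0) := by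
    have := Complex.GammaIntegral_convergent (s := w + 1) (by simp; linarith)
    refine this.congr_fun (fun t _ ↦ ?_) measurableSet_Ioi
    simp
  have hu'v : IntegrableOn (fun t : ℝ ↦ -((Real.exp (-t) : ℝ) : ℂ) * v t) (Ioi 0) := by
    refine IntegrableOn.congr_fun (hΓ.const_mul (-1 / w)) (fun t _ ↦ ?_) measurableSet_Ioi
    simp only [hvt]
    field_simp
  -- boundary terms
  have h_zero : Tendsto (fun t : ℝ ↦ abelWeight t * v t) (𝓝[>] 0) (𝓝 0) := by
    have hbound : ∀ t ∈ Ioi (0 : ℝ), ‖abelWeight t * v t‖ ≤ t ^ (w.re + 1) / ‖w‖ := by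
      intro t ht
      have ht0 : 0 < t := ht
      rw [hvt, norm_mul, norm_div, norm_cpow_eq_rpow_re_of_pos ht0]
      calc ‖abelWeight t‖ * (t ^ w.re / ‖w‖) ≤ t * (t ^ w.re / ‖w‖) :=
            mul_le_mul_of_nonneg_right ((norm_abelWeight_le ht0.le).trans (min_le_left _ _))
              (by positivity)
        _ = t ^ (w.re + 1) / ‖w‖ := by rw [Real.rpow_add_one ht0.ne']; ring
    have hlim : Tendsto (fun t : ℝ ↦ t ^ (w.re + 1) / ‖w‖) (𝓝[>] 0) (𝓝 0) := by
      have h1 : Tendsto (fun t : ℝ ↦ t ^ (w.re + 1)) (𝓝[>] 0) (𝓝 0) := by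
        have := (Real.continuousAt_rpow_const 0 (w.re + 1) (Or.inr (by linarith))).tendsto
        rw [Real.zero_rpow (by linarith)] at this
        exact this.mono_left nhdsWithin_le_nhds
      simpa using h1.div_const ‖w‖
    refine squeeze_zero_norm' ?_ hlim
    exact eventually_nhdsWithin_of_forall hbound
  have h_infty : Tendsto (fun t : ℝ ↦ abelWeight t * v t) atTop (𝓝 0) := by
    have hbound : ∀ᶠ t : ℝ in atTop, ‖abelWeight t * v t‖ ≤ t ^ (-(-w.re)) / ‖w‖ := by
      filter_upwards [eventually_gt_atTop 0] with t ht0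
      rw [hvt, norm_mul, norm_div, norm_cpow_eq_rpow_re_of_pos ht0, neg_neg]
      calc ‖abelWeight t‖ * (t ^ w.re / ‖w‖) ≤ 1 * (t ^ w.re / ‖w‖) :=
            mul_le_mul_of_nonneg_right ((norm_abelWeight_le ht0.le).trans (min_le_right _ _))
              (by positivity)
        _ = _ := one_mul _
    have hlim : Tendsto (fun t : ℝ ↦ t ^ (-(-w.re)) / ‖w‖) atTop (𝓝 0) := by
      simpa using (tendsto_rpow_neg_atTop (by linarith : 0 < -w.re)).div_const ‖w‖
    exact squeeze_zero_norm' hbound hlim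
  -- integration by parts
  have hibp := integral_Ioi_mul_deriv_eq_deriv_mul (a := 0) (u := abelWeight)
    (u' := fun t ↦ -((Real.exp (-t) : ℝ) : ℂ)) (v := v) (v' := fun t ↦ (t : ℂ) ^ (w - 1))
    (fun t _ ↦ hasDerivAt_abelWeight t) hv' huv' hu'v h_zero h_infty
  -- assemble
  have hmel : mellin abelWeight w = ∫ t in Ioi (0 : ℝ), abelWeight t * (t : ℂ) ^ (w - 1) := by
    rw [mellin]
    refine setIntegral_congr_fun measurableSet_Ioi fun t _ ↦ ?_
    simp [smul_eq_mul, mul_comm]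
  have hGam : ∫ t in Ioi (0 : ℝ), -((Real.exp (-t) : ℝ) : ℂ) * v t = -(Gamma (w + 1) / w) := by
    have h1 : ∫ t in Ioi (0 : ℝ), -((Real.exp (-t) : ℝ) : ℂ) * v t =
        -(1 / w) * ∫ t in Ioi (0 : ℝ), ((Real.exp (-t) : ℝ) : ℂ) * (t : ℂ) ^ w := by
      rw [← integral_const_mul]
      refine setIntegral_congr_fun measurableSet_Ioi fun t _ ↦ ?_
      rw [hvt]; ring
    rw [h1, Complex.Gamma_eq_integral (by simp; linarith), Complex.GammaIntegral]
    have h2 : ∫ t in Ioi (0 : ℝ), ((Real.exp (-t) : ℝ) : ℂ) * (t : ℂ) ^ w =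
        ∫ t in Ioi (0 : ℝ), ((-t).exp : ℂ) * (t : ℂ) ^ (w + 1 - 1) := by
      refine setIntegral_congr_fun measurableSet_Ioi fun t _ ↦ ?_
      simp
    rw [h2]; ring
  rw [hmel, hibp, hGam, Complex.Gamma_add_one _ hw_ne]
  field_simp
  ring

/-- **`Γ` on the strip `−1 < Re w < 0`**: `‖Γ(w)‖ ≤ Γ(Re w + 2)/(‖w‖‖w + 1‖)` (functional equation
twice). [folklore] -/
theorem norm_Gamma_le_of_re_mem {w : ℂ} (hw1 : -1 < w.re) (hw0 : w.re < 0) :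
    ‖Gamma w‖ ≤ Real.Gamma (w.re + 2) / (‖w‖ * ‖w + 1‖) := by
  have hw_ne : w ≠ 0 := by rintro rfl; simp at hw0
  have hw1_ne : w + 1 ≠ 0 := by
    intro h; have := congrArg re h; simp at this; linarith
  have h2 : Gamma (w + 2) = (w + 1) * (w * Gamma w) := by
    rw [show w + 2 = (w + 1) + 1 by ring, Complex.Gamma_add_one _ hw1_ne, Complex.Gamma_add_one _ hw_ne]
  have hΓ : Gamma w = Gamma (w + 2) / (w * (w + 1)) := by
    rw [h2]; field_simp
  rw [hΓ, norm_div, norm_mul]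
  refine div_le_div_of_nonneg_right ?_ (by positivity)
  have h2' : w + 2 = ((w.re + 2 : ℝ) : ℂ) + w.im * I := by
    apply Complex.ext <;> simp
  rw [h2']
  exact GammaVert.norm_Gamma_le_Gamma_re (x := w.re + 2) (by linarith) w.im

/-- `Γ` is integrable along every line `Re w = α` with `−1 < α < 0`. [folklore] -/
theorem integrable_Gamma_line {α : ℝ} (hα1 : -1 < α) (hα0 : α < 0) :
    Integrable fun y : ℝ ↦ Gamma ((α : ℂ) + y * I) := by
  have hα0' : α ≠ 0 := hα0.ne
  have hα1' : α + 1 ≠ 0 := by intro h; linarith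
  have hcont : Continuous fun y : ℝ ↦ Gamma ((α : ℂ) + y * I) := by
    refine continuous_iff_continuousAt.2 fun y ↦ ?_
    refine (Complex.differentiableAt_Gamma _ fun m h ↦ ?_).continuousAt.comp
      (f := fun y : ℝ ↦ (α : ℂ) + y * I) (by fun_prop)
    have := congrArg re h
    simp at this
    have hm : (0 : ℝ) ≤ m := Nat.cast_nonneg m
    rcases Nat.eq_zero_or_pos m with hm0 | hm0
    · subst hm0; simp at this; exact hα0' this
    · have : (1 : ℝ) ≤ m := by exact_mod_cast hm0
      linarith
  refine Integrable.mono' (((integrable_one_div_sq_add_sq_of_ne_zero hα0').add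
    (integrable_one_div_sq_add_sq_of_ne_zero hα1')).const_mul
    (Real.Gamma (α + 2))) hcont.aestronglyMeasurable (Eventually.of_forall fun y ↦ ?_)
  have hre : ((α : ℂ) + y * I).re = α := by simp
  have h := norm_Gamma_le_of_re_mem (w := (α : ℂ) + y * I) (by rw [hre]; exact hα1) (by rw [hre]; exact hα0)
  rw [hre] at h
  refine h.trans ?_
  rw [div_eq_mul_one_div]
  exact mul_le_mul_of_nonneg_left (inv_norm_mul_norm_add_one_le hα0' hα1' y) (Real.Gamma_pos_of_pos (by linarith)).le

/-- **The smoothed Perron formula for the Abel means** (Montgomery's (5) "mutatis mutandis", the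
Cahen–Mellin integral shifted across `w = 0`): for `|a(n)| ≤ 1`, `−1 < α < 0`, `Re s + α > 1` and
`N ≥ 1`, `Σ_n e^{-n/N} a(n) n^{-s} = f(s) + (1/2π) ∫ f(s+α+iy) N^{α+iy} Γ(α+iy) dy`.
[cite: Montgomery1983, §1 p. 498 and §2 (5)] [cite: MontgomeryVaughan2007, §5.1 (5.22)] -/
theorem abel_twisted_eq {a : ℕ → ℂ} (ha : ∀ n, ‖a n‖ ≤ 1) {s : ℂ} {α : ℝ} (hα1 : -1 < α)
    (hα0 : α < 0) (hσ : 1 < s.re + α) {N : ℕ} (hN : 0 < N) :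
    LSeries (fun n ↦ ((Real.exp (-1 / (N : ℝ)) : ℝ) : ℂ) ^ n * a n) s =
      LSeries a s + (1 / (2 * Real.pi)) * ∫ y : ℝ, LSeries a (s + α + y * I) *
        (N : ℂ) ^ ((α : ℂ) + y * I) * Gamma ((α : ℂ) + y * I) := by
  have hs1 : 1 < s.re := by linarith
  have hN0 : (0 : ℝ) < N := by exact_mod_cast hN
  have hre : ∀ y : ℝ, ((α : ℂ) + y * I).re = α := fun y ↦ by simp
  have hg : MellinConvergent abelWeight α :=
    mellinConvergent_abelWeight (w := (α : ℂ)) (by simpa using hα1) (by simpa using hα0)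
  have key := integral_LSeries_mul_kernel_eq ha hσ (g := abelWeight) (κ := Gamma) hg
    (fun y ↦ mellin_abelWeight (by rw [hre]; exact hα1) (by rw [hre]; exact hα0))
    (integrable_Gamma_line hα1 hα0) (fun u _ ↦ continuous_abelWeight.continuousAt) hN0
  -- the right-hand side: `Σ_n term a s n · g_A(n/N) = Σ_n e^{-n/N} a(n) n^{-s} − f(s)`
  set r : ℝ := Real.exp (-1 / (N : ℝ)) with hr
  have hr0 : 0 < r := Real.exp_pos _
  have hr1 : r ≤ 1 := by
    rw [hr, Real.exp_le_one_iff, div_le_iff₀ hN0]; linarith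
  have hpt : ∀ n : ℕ, LSeries.term a s n * abelWeight ((n : ℝ) / N) =
      LSeries.term (fun n ↦ ((r : ℝ) : ℂ) ^ n * a n) s n - LSeries.term a s n := by
    intro n
    rcases eq_or_ne n 0 with rfl | hn
    · simp
    have hexp : Real.exp (-((n : ℝ) / N)) = r ^ n := by
      rw [hr, ← Real.exp_nat_mul]; congr 1; field_simp
    rw [LSeries.term_of_ne_zero hn, LSeries.term_of_ne_zero hn, abelWeight, hexp]
    push_cast
    ring
  have hL : Summable fun n ↦ LSeries.term a s n :=
    LSeriesSummable_of_bounded_of_one_lt_re (m := 1) (fun n _ ↦ ha n) hs1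
  have hLr : Summable fun n ↦ LSeries.term (fun n ↦ ((r : ℝ) : ℂ) ^ n * a n) s n := by
    refine LSeriesSummable_of_bounded_of_one_lt_re (m := 1) (fun n _ ↦ ?_) hs1
    rw [norm_mul, norm_pow, norm_real, Real.norm_eq_abs, abs_of_pos hr0]
    calc r ^ n * ‖a n‖ ≤ 1 * 1 :=
          mul_le_mul (pow_le_one₀ hr0.le hr1) (ha n) (norm_nonneg _) zero_le_one
      _ = 1 := one_mul _
  have htsum : ∑' n : ℕ, LSeries.term a s n * abelWeight ((n : ℝ) / N) =
      LSeries (fun n ↦ ((r : ℝ) : ℂ) ^ n * a n) s - LSeries a s := by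
    rw [tsum_congr hpt, hLr.tsum_sub hL, LSeries, LSeries]
  rw [htsum] at key
  have hx : ((N : ℝ) : ℂ) = (N : ℂ) := by push_cast; rfl
  rw [hx] at key
  rw [key]
  have hπ : (2 * Real.pi : ℂ) ≠ 0 := by exact_mod_cast (mul_ne_zero two_ne_zero Real.pi_ne_zero)
  field_simp
  ring

/-! ## The alternating signs: `Σ (−1)ⁿ a(n) n^{-z} = (2a(2)2^{-z} − 1) f(z)` -/

/-- **The Dirichlet series of `V_N`'s coefficients.** If `a` is completely multiplicative at `2`
(`a(2n) = a(2)a(n)`) and bounded by `1`, then for `Re z > 1`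
`Σ_n (−1)ⁿ a(n) n^{-z} = (2a(2)2^{-z} − 1) Σ_n a(n) n^{-z}` (split into even and odd `n`: the even
part is `a(2)2^{-z} f(z)`). [cite: Montgomery1983, §1 p. 498 (`V_N`)] -/
theorem LSeries_alternating_eq {ψ : ℕ → ℂ} (hmul : ∀ n, ψ (2 * n) = ψ 2 * ψ n)
    (hψ : ∀ n, ‖ψ n‖ ≤ 1) {z : ℂ} (hz : 1 < z.re) :
    LSeries (fun n ↦ (-1 : ℂ) ^ n * ψ n) z = (2 * ψ 2 * (2 : ℂ) ^ (-z) - 1) * LSeries ψ z := by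
  set T : ℕ → ℂ := fun n ↦ LSeries.term ψ z n with hT
  set TV : ℕ → ℂ := fun n ↦ LSeries.term (fun n ↦ (-1 : ℂ) ^ n * ψ n) z n with hTV
  have hTs : Summable T := LSeriesSummable_of_bounded_of_one_lt_re (m := 1) (fun n _ ↦ hψ n) hz
  have hTV_even : ∀ k, TV (2 * k) = T (2 * k) := by
    intro k
    rcases eq_or_ne k 0 with rfl | hk
    · simp [hTV, hT]
    simp only [hTV, hT, LSeries.term_of_ne_zero (show 2 * k ≠ 0 by omega), pow_mul, neg_one_sq,
      one_pow, one_mul]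
  have hTV_odd : ∀ k, TV (2 * k + 1) = -T (2 * k + 1) := by
    intro k
    simp only [hTV, hT, LSeries.term_of_ne_zero (show 2 * k + 1 ≠ 0 by omega), pow_succ, pow_mul]
    ring
  have h2z : (2 : ℂ) ^ z ≠ 0 := by
    rw [Ne, cpow_eq_zero_iff]; simp
  have hT_even : ∀ k, T (2 * k) = ψ 2 * (2 : ℂ) ^ (-z) * T k := by
    intro k
    rcases eq_or_ne k 0 with rfl | hk
    · simp [hT]
    have hkz : (k : ℂ) ^ z ≠ 0 := by
      rw [Ne, cpow_eq_zero_iff]; simp [hk]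
    simp only [hT, LSeries.term_of_ne_zero (show 2 * k ≠ 0 by omega), LSeries.term_of_ne_zero hk]
    rw [hmul, Nat.cast_mul, natCast_mul_natCast_cpow, cpow_neg]
    push_cast
    field_simp
  -- even and odd subseries
  have he : Summable fun k ↦ T (2 * k) :=
    hTs.comp_injective (mul_right_injective₀ (two_ne_zero' ℕ))
  have ho : Summable fun k ↦ T (2 * k + 1) :=
    hTs.comp_injective ((add_left_injective 1).comp (mul_right_injective₀ (two_ne_zero' ℕ)))
  set E : ℂ := ∑' k, T (2 * k) with hE
  set O : ℂ := ∑' k, T (2 * k + 1) with hO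
  have hsumT : LSeries ψ z = E + O := (he.hasSum.even_add_odd ho.hasSum).tsum_eq
  have hsumTV : LSeries (fun n ↦ (-1 : ℂ) ^ n * ψ n) z = E - O := by
    have h1 : HasSum (fun k ↦ TV (2 * k)) E := by
      simp_rw [hTV_even]; exact he.hasSum
    have h2 : HasSum (fun k ↦ TV (2 * k + 1)) (-O) := by
      simp_rw [hTV_odd]; exact ho.hasSum.neg
    have := (h1.even_add_odd h2).tsum_eq
    rw [LSeries, this]; ring
  have hEval : E = ψ 2 * (2 : ℂ) ^ (-z) * LSeries ψ z := by
    rw [hE, LSeries]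
    simp_rw [hT_even]
    exact tsum_mul_left
  rw [hsumTV]
  calc E - O = 2 * E - LSeries ψ z := by rw [hsumT]; ring
    _ = _ := by rw [hEval]; ring

end Literature.Barriers.RiemannHypothesis

end
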